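import Literature.NumberTheory.LFunctions.ZeroGaps
import Literature.NumberTheory.LFunctions.SubnormalZetaGapsLOneLowerBound
import Literature.NumberTheory.LFunctions.ZeroStatisticsProofs
import Literature.NumberTheory.LFunctions.ZetaArgVariation
import Literature.NumberTheory.LFunctions.ZetaFirstZeroCertificate
import Literature.NumberTheory.LFunctions.SelbergFujiiGapMoment
import Mathlib.MeasureTheory.Integral.IntervalIntegral.Basic
import HarnessLib

/-!
# A positive proportion of small SPACINGS between zeta zeros on RH, and small GAPS between
# distinct zeros (Bui–Goldston–Milinovich–Montgomery, Acta Arith. 210 (2023): Theorems 1–3,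
# Corollaries 1–2) — with the PROVED bridge from a positive density of distinct gaps below half
# the mean spacing to Conrey–Iwaniec's hypothesis (1.22)

LABEL (cell `landau-siegel`, sub-cell §C literature harvest, rung F-S3, rows T-005/T-006 of
`lit/HARVEST.md`; tag **E*-ℓ**: zero-spacing input of the Conrey–Iwaniec route). STATEMENT LAYER:
five NAMED FACTS (D-0014; `def … : Prop`, theorem-in-print, each with its hypothesis `RiemannHypothesis`
EXPLICIT — Mathlib's `RiemannHypothesis` for `ζ`; nothing asserted): Theorem 1 (`μ_D ≤ 0.6039`),
Theorem 2 (`μ_d ≤ 0.991`), Theorem 3 (the criterion `c(λ;r) > 0`), Corollary 1 (`≫ T^{1−o(1)}`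
small gaps between distinct zeros), Corollary 2 (`μ_D ≤ 0.6039`, `μ_{D_d} ≤ 1.0522`), all over the
tree's zero vocabulary (`zetaOrdinate`, `zetaZeroCount`, `zetaNormalizedGap` of `ZetaZeros.lean` /
`ZeroGaps.lean`; the print's `D(λ,T)`, `D_d(λ,T)`, `𝒜(λ)`, `c(λ;r)`, `n*` are DEFINED here in that
vocabulary) — plus PROVED BOOKKEEPING that states exactly what the programme's lever E*-ℓ would
need from this literature:

* `BGMM2023.gapCount_le_ncard_closeCriticalZeros_add` /
  `BGMM2023.le_ncard_closeCriticalZeros_of_gapDensityPos`: **on RH, a positive density of gaps between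
  DISTINCT consecutive zeros below `2πλ₀/log T` with `λ₀ < ½` (i.e. `μ_{D_d} < ½`) gives
  `#{ρ = ½+iγ ≤ T with a critical neighbour within (π/log γ)(1 − 1/√log γ)} ≫ T log T` for all
  large `T`** — Conrey–Iwaniec's count (1.22) with room to spare (they need `≫ T(log T)^{4/5}`);
* `BGMM2023.subnormalGapsHypothesis_of_eventually` / `…_of_gapDensityPos`: the passage from "all large `T`" to the
  tree's `SubnormalGapsHypothesis c` (which quantifies over EVERY `T ≥ 2001`) costs exactly one
  numerical input — one close pair (or multiple zero) of `ζ` below height `2001` — isolated as the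
  hypothesis `(closeCriticalZeros 2001).Nonempty` (a finite certified computation, not done here);
* `BGMM2023.lOne_lower_bound_of_gapDensityPos`: hence, modulo the named fact
  `conreyIwaniec2002_theorem12` (Conrey–Iwaniec 2002, Theorem 1.2, tree), RH + `μ_{D_d} < ½` + that
  one numerical input ⟹ `L(1,χ) ≫ (log q)^{−90}` for the real primitive odd `χ` mod `q > 4`.

The printed records sit at `0.6039` (spacings, with multiplicity) and `1.0522` (distinct gaps) —
the measured deficit to the knife edge `½` is `0.104` resp. `0.552` mean spacings at positive
density, and everything is RH-conditional (Conrey–Iwaniec, §1 p. 3: proving (1.22) under RH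
"one still cannot conclude unconditional, effective bound (1.23)"). WHY DISTINCT GAPS in the
bridge: the tree renders (1.22) as a count of DISTINCT ordinates (`Set.ncard`), while `D(λ,T)`
counts spacings WITH multiplicity; without an input on multiplicities a positive spacing density
does not bound the number of distinct ordinates from below (`spacingCount_le_gapCount_add` records
the exact bookkeeping: spacings = distinct gaps + repeated ordinates).

## What the source prints (held text `paper:arxiv-2208.02359`, corpus-tex chunks p0002–p0004,
read 2026-08-26)

H. M. Bui, D. A. Goldston, M. B. Milinovich, H. L. Montgomery, *Small gaps and small spacings
between zeta zeros*, Acta Arith. 210 (2023) 133–153, doi:10.4064/aa220731-15-2 [BuiEtAl2023].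

§1 (p0002:L17–60): "We assume the Riemann hypothesis (RH) throughout this paper. Let `½ + iγ`
denote a nontrivial zero of `ζ(s)`, and let `m(γ)` denote its multiplicity. … the non-decreasing
sequence `{γ}` of positive ordinates `γ > 0` which counts multiplicity, and also the increasing
sequence `{γ_d}` of distinct zeros … `N(T)` the number of zeros with `0 < γ ≤ T`, counting
multiplicity … Denote by `γ⁺` the next term `γ ≤ γ⁺` after `γ` in the sequence of ordinates …
`γ_d⁺` the next term `γ_d < γ_d⁺` in the sequence of distinct ordinates."
`μ := lim inf (γ⁺ − γ) log γ/2π` (1.2); `μ_d := lim inf (γ_d⁺ − γ_d) log γ_d/2π` (1.3);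
`D(λ,T) := N(T)⁻¹ #{0 < γ ≤ T : γ⁺ − γ ≤ 2πλ/log T}`, `D_d(λ,T) := N(T)⁻¹ #{0 < γ_d ≤ T :
γ_d⁺ − γ_d ≤ 2πλ/log T}` (1.4); `μ_D := inf{λ : lim inf_T D(λ,T) > 0}`,
`μ_{D_d} := inf{λ : lim inf_T D_d(λ,T) > 0}`.

> **Theorem 1** (p0003:L3–8). Assuming RH, we have `μ_D ≤ 0.6039`.

> **Theorem 2** (p0003:L12–16). Assuming RH, we have `μ_d ≤ 0.991`.

("our method does not produce a positive proportion of gaps and so we do not obtain a result for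
`μ_{D_d}`. Nevertheless, in an interval `[T,2T]`, we can show that there are `≫_ε T^{1−ε}` such
small gaps between distinct zeros", p0003:L18–21.)

> **Corollary 1** (p0003:L22–27). Assume RH and let `T` be large. Then, for any constant
> `C > log 4`, there are `≫ T exp(−C log T/log log T)` consecutive ordinates
> `γ_d, γ_d⁺ ∈ [T,2T]` of distinct zeros with `γ_d < γ_d⁺` and `γ_d⁺ − γ_d ≤ 0.991·2π/log T`.

§2 (p0003:L33–p0004:L12): `r̂(α) = ∫ r(u)e(−αu)du`; "For `λ > 0`, let `𝒜(λ)` denote the class of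
even, continuous, and real-valued functions `r ∈ L¹(ℝ)` satisfying (i) `r(0) = 1`; (ii) `r(u) ≤ 0`
if `|u| > λ`; (iii) `r̂(α) ≥ 0` for all `α ∈ ℝ`." `n* := lim sup_T N(T)⁻¹ Σ_{0<γ_d≤T} m(γ_d)²`.

> **Theorem 3** (p0004:L14–28). Assume RH. Let `r ∈ 𝒜(λ)` and define
> `c(λ;r) := r̂(0) − 1 + 2∫₀¹ α r̂(α) dα` (2.3). If there exists a `λ₀ > 0` and an `r ∈ 𝒜(λ₀)` such
> that `c(λ₀;r) > 0` for sufficiently large `T`, then we have `D(λ₀,T) ≫ 1` and `μ_D ≤ λ₀` (2.4).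
> If there exists a `λ* > 0` and an `r ∈ 𝒜(λ*)` such that `c(λ*;r) > n* − 1` for sufficiently
> large `T`, then we have `D_d(λ*,T) ≫ c(λ*;r)⁴` and `μ_{D_d} ≤ λ*` (2.5).

> **Corollary 2** (p0004:L30–33). Assuming RH, we have `μ_D ≤ 0.6039`, and `μ_{D_d} ≤ 1.0522`.

(Corollary 2 for `μ_D` = Theorem 3 with the Chirre–Gonçalves–de Laat test function; for `μ_{D_d}`
with `n* ≤ 1.3208` [CGdL], §4.) §1 p0003:L28–31: "there is a well-known connection between the
existence of small spacings between the zeros of the zeta function and the class number problem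
for imaginary quadratic fields. See the works of Conrey and Iwaniec [CI] and Montgomery and
Weinberger [MW]".

## Lean rendering / design choices (audit notes for ls-lit-ref)

* Zeros in the INDEX vocabulary of `ZetaZeros.lean`/`ZeroGaps.lean` (as `ZeroGapsExplicit.lean`,
  `ZetaGapRecordsRH.lean`): `γ_n = zetaOrdinate n` (0-indexed, non-decreasing, with multiplicity),
  `N(T) = zetaZeroCount T`, `{n | γ_n ≤ T} = {n | n < N(T)}` (`mem_zeroIndexSet_iff_holds`). The
  print's "`0 < γ ≤ T` with `γ⁺ − γ ≤ h`" is "`n < N(T)` with `γ_{n+1} − γ_n ≤ h`"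
  (`spacingCount`); a DISTINCT ordinate `γ_d ≤ T` corresponds to exactly one index `n < N(T)` with
  `γ_n < γ_{n+1}` (the last index of its block), and then `γ_d⁺ = γ_{n+1}` — so
  "`0 < γ_d ≤ T` with `γ_d⁺ − γ_d ≤ h`" is "`n < N(T)` with `γ_n < γ_{n+1} ≤ γ_n + h`" (`gapCount`),
  and `Σ_{γ_d ≤ T} m(γ_d)²` is the number of ordered pairs `(n, n′)` of indices `< N(T)` with
  `γ_n = γ_{n′}` (`multPairCount`).
* `lim inf_T D(λ,T) > 0` ⟺ `∃ A > 0, ∃ T₀, ∀ T ≥ T₀, A·N(T) ≤ #{…}` (`SpacingDensityPos λ`; the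
  shape of the tree's `selberg_fujii_small_gaps`); since `D(λ,T)` is non-decreasing in `λ`, the
  set `{λ : lim inf D(λ,·) > 0}` is an upper ray and **`μ_D ≤ c` ⟺ `∀ λ > c, SpacingDensityPos λ`**
  (`MuDLe c`); likewise `MuDdLe c` for `μ_{D_d}`. `μ_d ≤ c` (a `lim inf` over the distinct
  consecutive pairs) ⟺ for every `θ > c`, infinitely many `n` have `γ_n < γ_{n+1}` and
  `(γ_{n+1} − γ_n) log γ_n/2π ≤ θ` (`MudLe c`, with the tree's `zetaNormalizedGap`).
* `𝒜(λ)`: `IsAdmissible r λ` — `r` even, continuous, integrable, `r(0) = 1`, `r(u) ≤ 0` for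
  `|u| > λ`, and `r̂ ≥ 0` with `r̂(α) = ∫ r(u) cos(2παu) du` (`cosTransform`; for EVEN real `r` this
  IS `∫ r(u)e(−αu)du`, which is then real — so (iii) is stated on the cosine transform, avoiding a
  complex-valued `𝓕`). `c(λ;r)` = `cValue r` (it does not depend on `λ` or `T`; the print's "for
  sufficiently large `T`" is vacuous and dropped).
* "`D(λ₀,T) ≫ 1`", "`D_d(λ*,T) ≫ c(λ*;r)⁴`": the implied constants are not specified in print, so
  the faithful logical content is `SpacingDensityPos λ₀` resp. `GapDensityPos λ*` (an unspecified
  `A > 0`); "`c(λ*;r) > n* − 1`" with `n*` a `lim sup` is rendered `∃ ν < c(λ*;r) + 1` bounding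
  `Σ m(γ_d)² ≤ ν N(T)` for all large `T` (equivalent for a `lim sup`).
* Corollary 1: "`T` large … `≫`" with `C` fixed first ⟹ `∀ C > log 4, ∃ κ > 0, ∃ T₀, ∀ T ≥ T₀`;
  both ordinates in `[T, 2T]` (indices `n < N(2T)` with `T ≤ γ_n`, `γ_{n+1} ≤ 2T`).
* Numerical constants verbatim: `0.6039`, `0.991`, `1.0522`, `log 4`.

WHAT THIS IS NOT: no claim about RH, about the actual spacing of the zeros of `ζ`, or about Siegel
zeros; the bridge theorems are implications with every hypothesis explicit. «The programme
SEARCHES and TYPES; no claim about Landau–Siegel zeros, Theorems 1–2 of arXiv:2211.02515 or a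
repaired Margin232 until a kernel theorem says so.»

## References

* [BuiEtAl2023] H. M. Bui, D. A. Goldston, M. B. Milinovich, H. L. Montgomery, *Small gaps and
  small spacings between zeta zeros*, Acta Arith. 210 (2023) 133–153, arXiv:2208.02359: §1
  (1.2)–(1.4), Theorems 1–2, Corollary 1; §2 (2.1)–(2.5), Theorem 3, Corollary 2.
* [ConreyIwaniec2002] B. Conrey, H. Iwaniec, Acta Arith. 103 (2002), Theorem 1.2 (1.22)–(1.23) and
  §1 p. 3 (tree: `SubnormalZetaGapsLOneLowerBound.lean`).
* Tree: `ZetaZeros.lean`, `ZeroGaps.lean`, `ZeroGapsExplicit.lean`, `ZetaGapRecordsRH.lean`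
  (vocabulary and the `μ`-records), `ZetaArgVariation.lean` / `ZeroStatisticsProofs.lean` /
  `ZetaFirstZeroCertificate.lean` / `SelbergFujiiGapMoment.lean` (the proved zero-counting inputs).
-/

noncomputable section

open Real Filter Complex

namespace Literature.NumberTheory.LFunctions

namespace BGMM2023

/-! ### The counting functions of (1.4) in the index vocabulary -/

/-- **`N(T)·D(λ,T) = #{0 < γ ≤ T : γ⁺ − γ ≤ 2πλ/log T}`** — spacings WITH multiplicity: indices
`n < N(T)` (`⟺ γ_n ≤ T`) with `γ_{n+1} − γ_n ≤ 2πλ/log T`. [cite: BuiEtAl2023, §1 (1.4)] -/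
def spacingCount (lam T : ℝ) : ℕ :=
  ((Finset.range (zetaZeroCount T)).filter fun n =>
      zetaOrdinate (n + 1) - zetaOrdinate n ≤ 2 * π * lam / Real.log T).card

/-- **`N(T)·D_d(λ,T) = #{0 < γ_d ≤ T : γ_d⁺ − γ_d ≤ 2πλ/log T}`** — gaps between DISTINCT
consecutive zeros: indices `n < N(T)` with `γ_n < γ_{n+1} ≤ γ_n + 2πλ/log T` (the last index of
the block of a distinct ordinate `γ_d = γ_n`, so that `γ_{n+1} = γ_d⁺`).
[cite: BuiEtAl2023, §1 (1.4)] -/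
def gapCount (lam T : ℝ) : ℕ :=
  ((Finset.range (zetaZeroCount T)).filter fun n =>
      zetaOrdinate n < zetaOrdinate (n + 1) ∧
        zetaOrdinate (n + 1) - zetaOrdinate n ≤ 2 * π * lam / Real.log T).card

/-- The number of REPEATED ordinates up to `T`: indices `n < N(T)` with `γ_{n+1} = γ_n`
(`= Σ_{γ_d ≤ T} (m(γ_d) − 1) = N(T) − #{γ_d ≤ T}` up to the boundary block).
[cite: BuiEtAl2023, §1 (1.1)] -/
def repeatCount (T : ℝ) : ℕ :=
  ((Finset.range (zetaZeroCount T)).filter fun n => zetaOrdinate (n + 1) = zetaOrdinate n).card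

/-- **`Σ_{0 < γ_d ≤ T} m(γ_d)²`**, the numerator of `n*`: ordered pairs of indices `n, n′ < N(T)`
with `γ_n = γ_{n′}` (a distinct ordinate of multiplicity `m` contributes `m²` pairs).
[cite: BuiEtAl2023, §2 (before Theorem 3)] -/
def multPairCount (T : ℝ) : ℕ :=
  ((Finset.range (zetaZeroCount T) ×ˢ Finset.range (zetaZeroCount T)).filter fun p =>
      zetaOrdinate p.1 = zetaOrdinate p.2).card

/-- **`D(λ,T)`** (1.4). [cite: BuiEtAl2023, §1 (1.4)] -/
def spacingDensity (lam T : ℝ) : ℝ :=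
  spacingCount lam T / zetaZeroCount T

/-- **`D_d(λ,T)`** (1.4). [cite: BuiEtAl2023, §1 (1.4)] -/
def gapDensity (lam T : ℝ) : ℝ :=
  gapCount lam T / zetaZeroCount T

/-- **`lim inf_{T→∞} D(λ,T) > 0`**: for some `A > 0` and all large `T`, at least `A·N(T)` of the
spacings up to `T` are `≤ 2πλ/log T` (the positive-proportion shape of the tree's
`selberg_fujii_small_gaps`). [cite: BuiEtAl2023, §1 (after (1.4))] -/
def SpacingDensityPos (lam : ℝ) : Prop :=
  ∃ A : ℝ, 0 < A ∧ ∃ T₀ : ℝ, ∀ T : ℝ, T₀ ≤ T → A * zetaZeroCount T ≤ (spacingCount lam T : ℝ)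

/-- **`lim inf_{T→∞} D_d(λ,T) > 0`** (distinct gaps). [cite: BuiEtAl2023, §1 (after (1.4))] -/
def GapDensityPos (lam : ℝ) : Prop :=
  ∃ A : ℝ, 0 < A ∧ ∃ T₀ : ℝ, ∀ T : ℝ, T₀ ≤ T → A * zetaZeroCount T ≤ (gapCount lam T : ℝ)

/-- **`μ_D ≤ c`**, `μ_D := inf{λ : lim inf_T D(λ,T) > 0}`: since `D(λ,T)` is non-decreasing in
`λ` the set is an upper ray, so `μ_D ≤ c` iff every `λ > c` has positive spacing density.
[cite: BuiEtAl2023, §1 (definition of μ_D)] -/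
def MuDLe (c : ℝ) : Prop :=
  ∀ lam : ℝ, c < lam → SpacingDensityPos lam

/-- **`μ_{D_d} ≤ c`**, `μ_{D_d} := inf{λ : lim inf_T D_d(λ,T) > 0}`.
[cite: BuiEtAl2023, §1 (definition of μ_{D_d})] -/
def MuDdLe (c : ℝ) : Prop :=
  ∀ lam : ℝ, c < lam → GapDensityPos lam

/-- **`μ_d ≤ c`**, `μ_d := lim inf (γ_d⁺ − γ_d) log γ_d/2π` over DISTINCT consecutive ordinates
(1.3): for every `θ > c`, infinitely many indices `n` with `γ_n < γ_{n+1}` (so `γ_n` is the last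
index of a distinct ordinate `γ_d` and `γ_{n+1} = γ_d⁺`) have normalised gap
`(γ_{n+1} − γ_n) log γ_n/2π ≤ θ` (the tree's `zetaNormalizedGap n`).
[cite: BuiEtAl2023, §1 (1.3)] -/
def MudLe (c : ℝ) : Prop :=
  ∀ θ : ℝ, c < θ → ∃ᶠ n : ℕ in atTop,
    zetaOrdinate n < zetaOrdinate (n + 1) ∧ zetaNormalizedGap n ≤ θ

/-! ### The class `𝒜(λ)` and the criterion constant `c(λ;r)` of §2 -/

/-- **`r̂(α) = ∫_ℝ r(u) cos(2παu) du`** — for an even real `r ∈ L¹` this is the Fourier transform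
`∫ r(u) e(−αu) du` of (2.1) (which is then real). [cite: BuiEtAl2023, §2 (2.1)] -/
def cosTransform (r : ℝ → ℝ) (α : ℝ) : ℝ :=
  ∫ u : ℝ, r u * Real.cos (2 * π * α * u)

/-- **The class `𝒜(λ)`** (§2): "even, continuous, and real-valued functions `r ∈ L¹(ℝ)`
satisfying (i) `r(0) = 1`; (ii) `r(u) ≤ 0` if `|u| > λ`; (iii) `r̂(α) ≥ 0` for all `α ∈ ℝ`."
[cite: BuiEtAl2023, §2 (definition of 𝒜(λ))] -/
structure IsAdmissible (r : ℝ → ℝ) (lam : ℝ) : Prop where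
  even : ∀ u : ℝ, r (-u) = r u
  continuous : Continuous r
  integrable : MeasureTheory.Integrable r
  map_zero : r 0 = 1
  nonpos : ∀ u : ℝ, lam < |u| → r u ≤ 0
  transform_nonneg : ∀ α : ℝ, 0 ≤ cosTransform r α

/-- **`c(λ;r) := r̂(0) − 1 + 2∫₀¹ α r̂(α) dα`** (2.3) (independent of `λ` and `T`).
[cite: BuiEtAl2023, Theorem 3 (2.3)] -/
def cValue (r : ℝ → ℝ) : ℝ :=
  cosTransform r 0 - 1 + 2 * ∫ α in (0 : ℝ)..1, α * cosTransform r α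

/-! ### API (proved) -/

/-- The distinct-gap count is at most the spacing count. [cite: BuiEtAl2023, §1 (1.4)] -/
theorem gapCount_le_spacingCount (lam T : ℝ) : gapCount lam T ≤ spacingCount lam T := by
  unfold gapCount spacingCount
  exact Finset.card_le_card (Finset.monotone_filter_right _ fun n _ h => h.2)

/-- **Spacings = distinct gaps + repeated ordinates**: every counted spacing `γ_{n+1} − γ_n ≤ h` is
either a genuine gap (`γ_n < γ_{n+1}`) or a repeat (`γ_{n+1} = γ_n`) — the bookkeeping behind
"the small spacings that are detected [may be] composed entirely from zero spacings between
multiple zeros". [cite: BuiEtAl2023, §1 (after Theorem 1)] -/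
theorem spacingCount_le_gapCount_add (lam T : ℝ) :
    spacingCount lam T ≤ gapCount lam T + repeatCount T := by
  classical
  unfold spacingCount gapCount repeatCount
  rw [← Finset.card_union_of_disjoint]
  · refine Finset.card_le_card fun n hn => ?_
    rw [Finset.mem_filter] at hn
    rw [Finset.mem_union, Finset.mem_filter, Finset.mem_filter]
    have hmono : zetaOrdinate n ≤ zetaOrdinate (n + 1) := zetaOrdinate_mono_holds (Nat.le_succ n)
    rcases hmono.lt_or_eq with h | h
    · exact Or.inl ⟨hn.1, h, hn.2⟩
    · exact Or.inr ⟨hn.1, h.symm⟩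
  · rw [Finset.disjoint_filter]
    intro n _ h
    exact ne_of_gt h.1

/-- The spacing count is monotone in `λ`. [cite: BuiEtAl2023, §1 (1.4)] -/
theorem spacingCount_mono {lam lam' : ℝ} (h : lam ≤ lam') {T : ℝ} (hT : 1 ≤ T) :
    spacingCount lam T ≤ spacingCount lam' T := by
  unfold spacingCount
  refine Finset.card_le_card (Finset.monotone_filter_right _ fun n _ hn => hn.trans ?_)
  have hlog : 0 ≤ Real.log T := Real.log_nonneg hT
  exact div_le_div_of_nonneg_right (by nlinarith [Real.pi_pos]) hlog

/-- The distinct-gap count is monotone in `λ`. [cite: BuiEtAl2023, §1 (1.4)] -/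
theorem gapCount_mono {lam lam' : ℝ} (h : lam ≤ lam') {T : ℝ} (hT : 1 ≤ T) :
    gapCount lam T ≤ gapCount lam' T := by
  unfold gapCount
  refine Finset.card_le_card (Finset.monotone_filter_right _ fun n _ hn => ⟨hn.1, hn.2.trans ?_⟩)
  have hlog : 0 ≤ Real.log T := Real.log_nonneg hT
  exact div_le_div_of_nonneg_right (by nlinarith [Real.pi_pos]) hlog

/-- Positive spacing density is inherited by larger `λ`. [cite: BuiEtAl2023, §1 (1.4)] -/
theorem SpacingDensityPos.mono {lam lam' : ℝ} (h : lam ≤ lam') (hd : SpacingDensityPos lam) :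
    SpacingDensityPos lam' := by
  obtain ⟨A, hA, T₀, hT₀⟩ := hd
  refine ⟨A, hA, max T₀ 1, fun T hT => (hT₀ T (le_of_max_le_left hT)).trans ?_⟩
  exact_mod_cast spacingCount_mono h (le_of_max_le_right hT)

/-- Positive distinct-gap density is inherited by larger `λ`. [cite: BuiEtAl2023, §1 (1.4)] -/
theorem GapDensityPos.mono {lam lam' : ℝ} (h : lam ≤ lam') (hd : GapDensityPos lam) :
    GapDensityPos lam' := by
  obtain ⟨A, hA, T₀, hT₀⟩ := hd
  refine ⟨A, hA, max T₀ 1, fun T hT => (hT₀ T (le_of_max_le_left hT)).trans ?_⟩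
  exact_mod_cast gapCount_mono h (le_of_max_le_right hT)

/-- A positive distinct-gap density is a positive spacing density (`μ_D ≤ μ_{D_d}`).
[cite: BuiEtAl2023, §1 ("μ ≤ μ_D ≤ μ_{D_d}")] -/
theorem GapDensityPos.spacingDensityPos {lam : ℝ} (hd : GapDensityPos lam) :
    SpacingDensityPos lam := by
  obtain ⟨A, hA, T₀, hT₀⟩ := hd
  refine ⟨A, hA, T₀, fun T hT => (hT₀ T hT).trans ?_⟩
  exact_mod_cast gapCount_le_spacingCount lam T

/-- `μ_D ≤ c` is inherited by larger `c`. [cite: BuiEtAl2023, §1 (definition of μ_D)] -/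
theorem MuDLe.mono {c c' : ℝ} (h : c ≤ c') (hc : MuDLe c) : MuDLe c' :=
  fun lam hlam => hc lam (lt_of_le_of_lt h hlam)

/-- `μ_D ≤ μ_{D_d}`: `μ_{D_d} ≤ c` implies `μ_D ≤ c`. [cite: BuiEtAl2023, §1 ("μ_D ≤ μ_{D_d}")] -/
theorem MuDdLe.muDLe {c : ℝ} (hc : MuDdLe c) : MuDLe c :=
  fun lam hlam => (hc lam hlam).spacingDensityPos

end BGMM2023

open BGMM2023

/-! ### The named facts (RH-conditional theorems of print; nothing asserted) -/

/-- **Bui–Goldston–Milinovich–Montgomery 2023, Theorem 1.** "Assuming RH, we have `μ_D ≤ 0.6039`."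
Here `μ_D = inf{λ : lim inf_T D(λ,T) > 0}` with `D(λ,T) = N(T)⁻¹ #{0 < γ ≤ T : γ⁺ − γ ≤ 2πλ/log T}`
(ordinates of the non-trivial zeros of `ζ` WITH multiplicity, `γ⁺` the next one): on RH, for every
`λ > 0.6039` a positive proportion of the spacings between consecutive zeros up to `T` are at most
`λ` mean spacings `2π/log T`. (Montgomery's pair-correlation method, via Theorem 3 with the
Chirre–Gonçalves–de Laat test function.) NAMED FACT with RH explicit; users take
`(h : buiEtAl2023_theorem1)`. [cite: BuiEtAl2023, Theorem 1] -/
def buiEtAl2023_theorem1 : Prop :=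
  RiemannHypothesis → MuDLe 0.6039

/-- **Bui–Goldston–Milinovich–Montgomery 2023, Theorem 2.** "Assuming RH, we have `μ_d ≤ 0.991`",
`μ_d = lim inf (γ_d⁺ − γ_d) log γ_d/2π` over DISTINCT consecutive ordinates (1.3): on RH, for every
`θ > 0.991` there are infinitely many genuine gaps (not zero spacings of a multiple zero) of at most
`θ` mean spacings ("The method … produces gaps between a simple zero and a distinct zero of odd
multiplicity … our method does not produce a positive proportion of gaps"). NAMED FACT with RH
explicit. [cite: BuiEtAl2023, Theorem 2] -/
def buiEtAl2023_theorem2 : Prop :=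
  RiemannHypothesis → MudLe 0.991

/-- **Bui–Goldston–Milinovich–Montgomery 2023, Theorem 3** (the criterion). "Assume RH. Let
`r ∈ 𝒜(λ)` and define `c(λ;r) := r̂(0) − 1 + 2∫₀¹ α r̂(α) dα`. If there exists a `λ₀ > 0` and an
`r ∈ 𝒜(λ₀)` such that `c(λ₀;r) > 0` …, then we have `D(λ₀,T) ≫ 1` and `μ_D ≤ λ₀`. If there exists a
`λ* > 0` and an `r ∈ 𝒜(λ*)` such that `c(λ*;r) > n* − 1` …, then we have `D_d(λ*,T) ≫ c(λ*;r)⁴`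
and `μ_{D_d} ≤ λ*`." `𝒜(λ)` = even continuous real `r ∈ L¹`, `r(0) = 1`, `r(u) ≤ 0` for `|u| > λ`,
`r̂ ≥ 0` (`IsAdmissible`); `n* = lim sup N(T)⁻¹ Σ_{γ_d ≤ T} m(γ_d)²` (`multPairCount`). Rendered: the
implied constants of "`≫`" are not specified in print, so the conclusions are `SpacingDensityPos λ₀`
resp. `GapDensityPos λ*` (which give `μ_D ≤ λ₀`, `μ_{D_d} ≤ λ*` by monotonicity,
`SpacingDensityPos.mono`); "`> n* − 1`" for the `lim sup` as "`Σ m(γ_d)² ≤ ν N(T)` for all large `T`,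
for some `ν < c(λ*;r) + 1`". NAMED FACT with RH explicit (it rests on Propositions 1–2: Montgomery's
`F(α)` on `[−1,1]` and Selberg-type moment bounds for `N(t + h) − N(t)`).
[cite: BuiEtAl2023, Theorem 3] -/
def buiEtAl2023_theorem3 : Prop :=
  RiemannHypothesis →
    (∀ (lam : ℝ) (r : ℝ → ℝ), 0 < lam → IsAdmissible r lam → 0 < cValue r →
        SpacingDensityPos lam) ∧
      ∀ (lam : ℝ) (r : ℝ → ℝ), 0 < lam → IsAdmissible r lam →
        (∃ ν : ℝ, ν < cValue r + 1 ∧ ∃ T₀ : ℝ, ∀ T : ℝ, T₀ ≤ T →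
            (multPairCount T : ℝ) ≤ ν * zetaZeroCount T) →
          GapDensityPos lam

/-- **Bui–Goldston–Milinovich–Montgomery 2023, Corollary 1.** "Assume RH and let `T` be large.
Then, for any constant `C > log 4`, there are `≫ T exp(−C log T/log log T)` consecutive ordinates
`γ_d, γ_d⁺ ∈ [T,2T]` of distinct zeros with `γ_d < γ_d⁺` and `γ_d⁺ − γ_d ≤ 0.991·2π/log T`."
Rendered: `∀ C > log 4, ∃ κ > 0, ∃ T₀, ∀ T ≥ T₀`, the pairs as indices `n < N(2T)` with
`T ≤ γ_n < γ_{n+1} ≤ 2T`. NAMED FACT with RH explicit. [cite: BuiEtAl2023, Corollary 1] -/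
def buiEtAl2023_corollary1 : Prop :=
  RiemannHypothesis →
    ∀ C : ℝ, Real.log 4 < C → ∃ κ : ℝ, 0 < κ ∧ ∃ T₀ : ℝ, ∀ T : ℝ, T₀ ≤ T →
      κ * T * Real.exp (-C * Real.log T / Real.log (Real.log T)) ≤
        (((Finset.range (zetaZeroCount (2 * T))).filter fun n =>
            T ≤ zetaOrdinate n ∧ zetaOrdinate (n + 1) ≤ 2 * T ∧
              zetaOrdinate n < zetaOrdinate (n + 1) ∧
                zetaOrdinate (n + 1) - zetaOrdinate n ≤ 0.991 * (2 * π / Real.log T)).card : ℝ)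

/-- **Bui–Goldston–Milinovich–Montgomery 2023, Corollary 2.** "Assuming RH, we have
`μ_D ≤ 0.6039`, and `μ_{D_d} ≤ 1.0522`." (The second bound uses `n* ≤ 1.3208` of
Chirre–Gonçalves–de Laat: on RH at least `84.77%` of the zeros are distinct, "the average spacing
between distinct zeros could be as large as `1.17966` times the average spacing between all
zeros".) NAMED FACT with RH explicit. [cite: BuiEtAl2023, Corollary 2] -/
def buiEtAl2023_corollary2 : Prop :=
  RiemannHypothesis → MuDLe 0.6039 ∧ MuDdLe 1.0522

/-! ### Bookkeeping between the facts (proved) -/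

/-- Corollary 2 contains Theorem 1. [cite: BuiEtAl2023, Corollary 2] -/
theorem buiEtAl2023_theorem1_of_corollary2 (h : buiEtAl2023_corollary2) : buiEtAl2023_theorem1 :=
  fun hRH => (h hRH).1

/-- **The positive-proportion record beats the tree's Selberg–Fujii shape at `0.6039`, on RH**:
Theorem 1 gives, for every `μ₀ ∈ (0.6039, 1)`, a positive proportion of `n < N(T)` with
`γ_{n+1} − γ_n ≤ 2πμ₀/log T ≤ 2πμ₀/log γ_n`, i.e. normalised gap `δ_n ≤ μ₀` — the hypothesis shape
`selberg_fujii_small_gaps` of `ZeroGaps.lean` (there unconditional with an inexplicit `μ < 1`).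
[cite: BuiEtAl2023, Theorem 1] -/
theorem selberg_fujii_small_gaps_of_buiEtAl2023 (h : buiEtAl2023_theorem1)
    (hRH : RiemannHypothesis) : selberg_fujii_small_gaps := by
  obtain ⟨A, hA, T₀, hT₀⟩ := h hRH 0.61 (by norm_num)
  refine ⟨0.61, by norm_num, A, hA, max T₀ 1, fun T hT => ?_⟩
  have hT1 : 1 ≤ T := le_of_max_le_right hT
  refine (hT₀ T (le_of_max_le_left hT)).trans ?_
  have hsub : ((Finset.range (zetaZeroCount T)).filter fun n =>
        zetaOrdinate (n + 1) - zetaOrdinate n ≤ 2 * π * 0.61 / Real.log T) ⊆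
      (Finset.range (zetaZeroCount T)).filter fun n => zetaNormalizedGap n ≤ 0.61 := by
    refine Finset.monotone_filter_right _ fun n hn hle => ?_
    have hγT : zetaOrdinate n ≤ T := mem_zeroIndexSet_iff_holds.mp hn
    have h14 : 14 < zetaOrdinate n :=
      lt_of_lt_of_le fourteen_lt_zetaOrdinate_zero_holds (zetaOrdinate_mono_holds (Nat.zero_le n))
    have hγ1 : 1 < zetaOrdinate n := by linarith
    have hlogγ : 0 < Real.log (zetaOrdinate n) := Real.log_pos hγ1
    have hlogT : Real.log (zetaOrdinate n) ≤ Real.log T := Real.log_le_log (by linarith) hγT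
    have hlogT0 : 0 < Real.log T := lt_of_lt_of_le hlogγ hlogT
    -- `δ_n = (γ_{n+1} − γ_n) log γ_n/(2π) ≤ (2π·0.61/log T)·log γ_n/(2π) ≤ 0.61`
    rw [zetaNormalizedGap_eq_mul_div, div_le_iff₀ (by positivity)]
    calc (zetaOrdinate (n + 1) - zetaOrdinate n) * Real.log (zetaOrdinate n)
        ≤ 2 * π * 0.61 / Real.log T * Real.log (zetaOrdinate n) :=
          mul_le_mul_of_nonneg_right hle hlogγ.le
      _ ≤ 2 * π * 0.61 / Real.log T * Real.log T := by gcongr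
      _ = 0.61 * (2 * π) := by field_simp
  exact_mod_cast Finset.card_le_card hsub

namespace BGMM2023

/-! ### The bridge to Conrey–Iwaniec's hypothesis (1.22) (proved) -/

/-- On RH every ordinate `γ_n` carries a zero ON the critical line: `ζ(½ + iγ_n) = 0`
(`exists_zero_of_zetaOrdinate_holds` + Mathlib's `RiemannHypothesis`). [cite: BuiEtAl2023, §1] -/
theorem riemannZeta_half_add_zetaOrdinate (hRH : RiemannHypothesis) (n : ℕ) :
    riemannZeta (1 / 2 + zetaOrdinate n * I) = 0 := by
  obtain ⟨σ, hσ0, hσ1, hz⟩ := exists_zero_of_zetaOrdinate_holds n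
  have hγ : 0 < zetaOrdinate n := zetaOrdinate_pos_holds n
  have hre : (σ + zetaOrdinate n * I : ℂ).re = 1 / 2 := by
    refine hRH _ hz ?_ ?_
    · rintro ⟨k, hk⟩
      have := congrArg Complex.im hk
      simp at this
      exact hγ.ne' this
    · intro h1
      have := congrArg Complex.im h1
      simp at this
      exact hγ.ne' this
  have hσ : σ = 1 / 2 := by simpa using hre
  rw [← hz, hσ]
  push_cast
  ring_nf

/-- The set `closeCriticalZeros T` of Conrey–Iwaniec's (1.22) is finite (it embeds in the tree's
finite zero box `zetaZeroBox 0 T` by `γ ↦ ½ + iγ`). [cite: ConreyIwaniec2002, Theorem 1.2 (1.22)] -/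
theorem closeCriticalZeros_finite (T : ℝ) : (closeCriticalZeros T).Finite := by
  have hsub : closeCriticalZeros T ⊆ (fun γ : ℝ => (1 / 2 : ℂ) + γ * I) ⁻¹' zetaZeroBox 0 T := by
    intro γ hγ
    obtain ⟨h0, hT, hz, _⟩ := hγ
    refine ⟨hz, ?_, ?_, ?_, ?_⟩
    · norm_num
    · norm_num
    · simpa using h0
    · simpa using hT
  refine Set.Finite.subset (Set.Finite.preimage ?_ (zetaZeroBox_finite 0 T)) hsub
  intro a _ b _ hab
  have := congrArg Complex.im hab
  simpa using this

/-- `closeCriticalZeros` is monotone in the height. [cite: ConreyIwaniec2002, Theorem 1.2 (1.22)] -/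
theorem closeCriticalZeros_mono {T T' : ℝ} (h : T ≤ T') :
    closeCriticalZeros T ⊆ closeCriticalZeros T' :=
  fun _ hγ => ⟨hγ.1, hγ.2.1.trans h, hγ.2.2⟩

/-- The radius comparison: for `0 ≤ λ < ½` and `log γ ≥ (1 − 2λ)⁻²` (and `γ ≤ T`, `γ > 1`),
`2πλ/log T ≤ (π/log γ)(1 − 1/√log γ)` — a spacing of `λ < ½` mean spacings is subnormal in
Conrey–Iwaniec's sense once `γ` is large. [cite: ConreyIwaniec2002, Theorem 1.2 (1.22)] -/
theorem two_pi_mul_div_log_le_ciRadius {lam γ T : ℝ} (hlam0 : 0 ≤ lam) (hlam : lam < 1 / 2)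
    (hγ1 : 1 < γ) (hγT : γ ≤ T) (hlog : (1 - 2 * lam)⁻¹ ^ 2 ≤ Real.log γ) :
    2 * π * lam / Real.log T ≤ ciRadius γ := by
  have hπ := Real.pi_pos
  have hlogγ : 0 < Real.log γ := Real.log_pos hγ1
  have hlogT : Real.log γ ≤ Real.log T := Real.log_le_log (by linarith) hγT
  have hlogT0 : 0 < Real.log T := lt_of_lt_of_le hlogγ hlogT
  have h12 : 0 < 1 - 2 * lam := by linarith
  -- `√(log γ) ≥ (1 − 2λ)⁻¹`, so `1/√(log γ) ≤ 1 − 2λ`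
  have hsqrt : (1 - 2 * lam)⁻¹ ≤ Real.sqrt (Real.log γ) := by
    rw [← Real.sqrt_sq (inv_nonneg.mpr h12.le)]
    exact Real.sqrt_le_sqrt hlog
  have hinvpos : 0 < (1 - 2 * lam)⁻¹ := inv_pos.mpr h12
  have hsqrtpos : 0 < Real.sqrt (Real.log γ) := lt_of_lt_of_le hinvpos hsqrt
  have hone : 1 / Real.sqrt (Real.log γ) ≤ 1 - 2 * lam := by
    rw [div_le_iff₀ hsqrtpos]
    calc (1 : ℝ) = (1 - 2 * lam) * (1 - 2 * lam)⁻¹ := by field_simp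
      _ ≤ (1 - 2 * lam) * Real.sqrt (Real.log γ) :=
          mul_le_mul_of_nonneg_left hsqrt h12.le
  -- compare the two radii through the common bound `2πλ/log γ`
  calc 2 * π * lam / Real.log T ≤ 2 * π * lam / Real.log γ :=
        div_le_div_of_nonneg_left (by positivity) hlogγ hlogT
    _ = π / Real.log γ * (2 * lam) := by ring
    _ ≤ π / Real.log γ * (1 - 1 / Real.sqrt (Real.log γ)) :=
        mul_le_mul_of_nonneg_left (by linarith) (by positivity)
    _ = ciRadius γ := by rw [ciRadius]

/-- **The counting bridge.** On RH, for `0 ≤ λ < ½` and `H₀ = exp((1 − 2λ)⁻²)`: every index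
`n < N(T)` with `γ_n < γ_{n+1} ≤ γ_n + 2πλ/log T` and `γ_n ≥ H₀` contributes the DISTINCT ordinate
`γ_n` to Conrey–Iwaniec's set (its critical neighbour is `γ_{n+1}`), and distinct such indices
have distinct ordinates; the indices with `γ_n < H₀` number at most `N(H₀)`. Hence
`gapCount λ T ≤ #closeCriticalZeros T + N(H₀)`. [cite: ConreyIwaniec2002, §1 p. 3 (PCC remark)] -/
theorem gapCount_le_ncard_closeCriticalZeros_add (hRH : RiemannHypothesis) {lam : ℝ}
    (hlam0 : 0 ≤ lam) (hlam : lam < 1 / 2) (T : ℝ) :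
    (gapCount lam T : ℝ) ≤
      (closeCriticalZeros T).ncard + zetaZeroCount (Real.exp ((1 - 2 * lam)⁻¹ ^ 2)) := by
  classical
  set H₀ : ℝ := Real.exp ((1 - 2 * lam)⁻¹ ^ 2) with hH₀
  set h : ℝ := 2 * π * lam / Real.log T with hh
  -- the counted indices, split at height `H₀`
  set G : Finset ℕ := (Finset.range (zetaZeroCount T)).filter fun n =>
      zetaOrdinate n < zetaOrdinate (n + 1) ∧ zetaOrdinate (n + 1) - zetaOrdinate n ≤ h with hG
  set G' : Finset ℕ := G.filter fun n => H₀ ≤ zetaOrdinate n with hG'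
  set L : Finset ℕ := G.filter fun n => ¬ H₀ ≤ zetaOrdinate n with hL
  have hsplit : G.card = G'.card + L.card := by
    rw [hG', hL]; exact (Finset.card_filter_add_card_filter_not _).symm
  -- low indices: `γ_n < H₀ ⇒ n < N(H₀)`
  have hLcard : L.card ≤ zetaZeroCount H₀ := by
    calc L.card ≤ (Finset.range (zetaZeroCount H₀)).card := by
          refine Finset.card_le_card fun n hn => ?_
          rw [hL, Finset.mem_filter] at hn
          exact mem_zeroIndexSet_iff_holds.mpr (le_of_lt (not_le.mp hn.2))
      _ = zetaZeroCount H₀ := Finset.card_range _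
  -- high indices inject into Conrey–Iwaniec's set
  have hinj : Set.InjOn zetaOrdinate (G' : Set ℕ) := by
    intro n hn m hm hnm
    rw [Finset.mem_coe, hG', Finset.mem_filter, hG, Finset.mem_filter] at hn hm
    by_contra hne
    rcases lt_or_gt_of_ne hne with hlt | hlt
    · have := lt_of_lt_of_le hn.1.2.1 (zetaOrdinate_mono_holds (Nat.succ_le_of_lt hlt))
      exact absurd hnm (ne_of_lt this)
    · have := lt_of_lt_of_le hm.1.2.1 (zetaOrdinate_mono_holds (Nat.succ_le_of_lt hlt))
      exact absurd hnm.symm (ne_of_lt this)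
  have himage : ((G'.image zetaOrdinate : Finset ℝ) : Set ℝ) ⊆ closeCriticalZeros T := by
    intro γ hγ
    rw [Finset.coe_image] at hγ
    obtain ⟨n, hn, rfl⟩ := hγ
    rw [Finset.mem_coe, hG', Finset.mem_filter, hG, Finset.mem_filter, Finset.mem_range] at hn
    obtain ⟨⟨hnN, hlt, hgap⟩, hH⟩ := hn
    have hγT : zetaOrdinate n ≤ T := mem_zeroIndexSet_iff_holds.mp (Finset.mem_range.mpr hnN)
    have hγpos : 0 < zetaOrdinate n := zetaOrdinate_pos_holds n
    have hγ1 : 1 < zetaOrdinate n := by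
      have h12 : 0 < 1 - 2 * lam := by linarith
      have hx : 0 < (1 - 2 * lam)⁻¹ ^ 2 := pow_pos (inv_pos.mpr h12) 2
      have : 1 < H₀ := by
        rw [hH₀]; linarith [Real.add_one_lt_exp hx.ne']
      linarith
    have hlogγ : (1 - 2 * lam)⁻¹ ^ 2 ≤ Real.log (zetaOrdinate n) := by
      rw [← Real.log_exp ((1 - 2 * lam)⁻¹ ^ 2)]
      exact Real.log_le_log (Real.exp_pos _) hH
    refine ⟨hγpos, hγT, riemannZeta_half_add_zetaOrdinate hRH n, Or.inr ?_⟩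
    refine ⟨zetaOrdinate (n + 1), ne_of_gt hlt, riemannZeta_half_add_zetaOrdinate hRH (n + 1), ?_⟩
    rw [abs_sub_comm, abs_of_pos (sub_pos.mpr hlt)]
    exact hgap.trans (two_pi_mul_div_log_le_ciRadius hlam0 hlam hγ1 hγT hlogγ)
  have hG'card : (G'.card : ℝ) ≤ (closeCriticalZeros T).ncard := by
    rw [← Finset.card_image_of_injOn hinj]
    have := Set.ncard_le_ncard himage (closeCriticalZeros_finite T)
    rw [Set.ncard_coe_finset] at this
    exact_mod_cast this
  have hGdef : gapCount lam T = G.card := rfl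
  rw [hGdef, hsplit, Nat.cast_add]
  have : (L.card : ℝ) ≤ zetaZeroCount H₀ := by exact_mod_cast hLcard
  linarith

/-- **On RH, `μ_{D_d} < ½` gives Conrey–Iwaniec's count with room to spare**: a positive density
of DISTINCT consecutive zeros within `λ₀ < ½` mean spacings yields `≫ T log T` ordinates `γ ≤ T`
of critical zeros with a critical neighbour within `(π/log γ)(1 − 1/√log γ)`, for all large `T`
(Riemann–von Mangoldt: `N(T) ≥ T log T/4π`, tree `SelbergFujii.exists_mul_log_le_zetaZeroCount`).
Conrey–Iwaniec, §1 p. 3: "The well justified Pair Correlation Conjecture … does imply (1.24)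
with any `θ > 0` for a positive density of zeros" — this is the formal counterpart of "a positive
density below `θ = ½` would give (1.22)". [cite: ConreyIwaniec2002, §1 p. 3 (PCC remark)] -/
theorem le_ncard_closeCriticalZeros_of_gapDensityPos (hRH : RiemannHypothesis) {lam : ℝ}
    (hlam0 : 0 ≤ lam) (hlam : lam < 1 / 2) (hd : GapDensityPos lam) :
    ∃ c : ℝ, 0 < c ∧ ∃ T₁ : ℝ, ∀ T : ℝ, T₁ ≤ T →
      c * T * Real.log T ≤ ((closeCriticalZeros T).ncard : ℝ) := by
  obtain ⟨A, hA, T₀, hT₀⟩ := hd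
  obtain ⟨T₂, hT₂⟩ := SelbergFujii.exists_mul_log_le_zetaZeroCount
  set N₀ : ℝ := (zetaZeroCount (Real.exp ((1 - 2 * lam)⁻¹ ^ 2)) : ℝ) with hN₀
  have hN₀0 : 0 ≤ N₀ := by positivity
  have hπ := Real.pi_pos
  -- threshold: `T ≥ T₀, T₂, e` and `A T/(8π) ≥ N₀`
  refine ⟨A / (8 * π), by positivity, max (max T₀ T₂) (max (Real.exp 1) (8 * π * N₀ / A)),
    fun T hT => ?_⟩
  simp only [max_le_iff] at hT
  obtain ⟨⟨hT0, hT2⟩, hTe, hTN⟩ := hT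
  have hTpos : 0 < T := lt_of_lt_of_le (Real.exp_pos 1) hTe
  have hlogT : 1 ≤ Real.log T := by
    rw [← Real.log_exp 1]; exact Real.log_le_log (Real.exp_pos 1) hTe
  have h1 := hT₀ T hT0
  have h2 := hT₂ T hT2
  have h3 := gapCount_le_ncard_closeCriticalZeros_add hRH hlam0 hlam T
  -- `A T log T/(4π) ≤ A N(T) ≤ gapCount ≤ ncard + N₀`
  have h4 : A * (T * Real.log T / (4 * π)) ≤ A * zetaZeroCount T := mul_le_mul_of_nonneg_left h2 hA.le
  have hN₀le : N₀ ≤ A * T / (8 * π) := by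
    rw [le_div_iff₀ (by positivity)]
    have := (div_le_iff₀ hA).mp hTN
    linarith
  have hN₀le' : N₀ ≤ A * T * Real.log T / (8 * π) := by
    refine hN₀le.trans ?_
    rw [div_le_div_iff_of_pos_right (by positivity)]
    calc A * T = A * T * 1 := (mul_one _).symm
      _ ≤ A * T * Real.log T := mul_le_mul_of_nonneg_left hlogT (by positivity)
  have : A / (8 * π) * T * Real.log T = A * (T * Real.log T / (4 * π)) - A * T * Real.log T / (8 * π) := by
    field_simp; ring
  rw [this]
  linarith

/-- **From `≫ T log T` for large `T` to Conrey–Iwaniec's `SubnormalGapsHypothesis`** (which asks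
`c·T(log T)^{4/5} ≤ #closeCriticalZeros T` for EVERY `T ≥ 2001`): the only extra input is that the
count is already non-zero at height `2001` — one pair of critical zeros of `ζ` below `2001` closer
than `(π/log γ)(1 − 1/√log γ)` (or one multiple zero), a finite numerical certificate not supplied
here. [cite: ConreyIwaniec2002, Theorem 1.2 (1.22)] -/
theorem subnormalGapsHypothesis_of_eventually
    (h : ∃ c : ℝ, 0 < c ∧ ∃ T₁ : ℝ, ∀ T : ℝ, T₁ ≤ T →
      c * T * Real.log T ≤ ((closeCriticalZeros T).ncard : ℝ))
    (h₀ : (closeCriticalZeros 2001).Nonempty) :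
    ∃ c : ℝ, 0 < c ∧ SubnormalGapsHypothesis c := by
  obtain ⟨c, hc, T₁, hT₁⟩ := h
  -- a common threshold `T* ≥ 2001, T₁` and the floor value `1` below it
  set Ts : ℝ := max T₁ 2001 with hTs
  have hTs2001 : (2001 : ℝ) ≤ Ts := le_max_right _ _
  have hTs1 : 1 ≤ Ts := by linarith
  have hTspos : 0 < Ts := by linarith
  have hlogTs : 0 < Real.log Ts := Real.log_pos (by linarith)
  set B : ℝ := Ts * Real.log Ts ^ ((4 : ℝ) / 5) with hB
  have hBpos : 0 < B := by positivity
  have hone : (1 : ℝ) ≤ (closeCriticalZeros 2001).ncard := by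
    have := (Set.ncard_pos (closeCriticalZeros_finite 2001)).mpr h₀
    exact_mod_cast this
  refine ⟨min c B⁻¹, lt_min hc (inv_pos.mpr hBpos), fun T hT => ?_⟩
  have hT1 : 1 < T := by linarith
  have hTpos : 0 < T := by linarith
  have hlogT1 : 1 ≤ Real.log T := by
    rw [← Real.log_exp 1]
    exact Real.log_le_log (Real.exp_pos 1) (le_trans (by linarith [Real.exp_one_lt_d9]) hT)
  have hlog45 : Real.log T ^ ((4 : ℝ) / 5) ≤ Real.log T := by
    conv_rhs => rw [← Real.rpow_one (Real.log T)]
    exact Real.rpow_le_rpow_of_exponent_le hlogT1 (by norm_num)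
  rcases le_or_gt Ts T with hle | hlt
  · -- large `T`: `min c B⁻¹ · T (log T)^{4/5} ≤ c T log T ≤ ncard`
    have hmain := hT₁ T ((le_max_left _ _).trans hle)
    have hX0 : 0 ≤ Real.log T ^ ((4 : ℝ) / 5) := Real.rpow_nonneg (by linarith) _
    calc min c B⁻¹ * T * Real.log T ^ ((4 : ℝ) / 5) ≤ c * T * Real.log T ^ ((4 : ℝ) / 5) :=
          mul_le_mul_of_nonneg_right (mul_le_mul_of_nonneg_right (min_le_left _ _) hTpos.le) hX0
      _ ≤ c * T * Real.log T := mul_le_mul_of_nonneg_left hlog45 (mul_nonneg hc.le hTpos.le)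
      _ ≤ _ := hmain
  · -- `2001 ≤ T < T*`: the left side is `≤ B⁻¹ · B = 1 ≤ ncard(2001) ≤ ncard(T)`
    have hmono : ((closeCriticalZeros 2001).ncard : ℝ) ≤ (closeCriticalZeros T).ncard := by
      exact_mod_cast Set.ncard_le_ncard (closeCriticalZeros_mono hT) (closeCriticalZeros_finite T)
    have hTB : T * Real.log T ^ ((4 : ℝ) / 5) ≤ B := by
      rw [hB]
      have hlogle : Real.log T ≤ Real.log Ts := Real.log_le_log hTpos hlt.le
      gcongr
    calc min c B⁻¹ * T * Real.log T ^ ((4 : ℝ) / 5)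
        ≤ B⁻¹ * (T * Real.log T ^ ((4 : ℝ) / 5)) := by
          rw [mul_assoc]
          exact mul_le_mul_of_nonneg_right (min_le_right _ _) (by positivity)
      _ ≤ B⁻¹ * B := mul_le_mul_of_nonneg_left hTB (inv_pos.mpr hBpos).le
      _ = 1 := inv_mul_cancel₀ hBpos.ne'
      _ ≤ _ := hone.trans hmono

/-- **RH + `μ_{D_d} < ½` ⟹ Conrey–Iwaniec's hypothesis (1.22)**, modulo the one numerical input at
height `2001`. [cite: ConreyIwaniec2002, §1 p. 3 (PCC remark)] -/
theorem subnormalGapsHypothesis_of_gapDensityPos (hRH : RiemannHypothesis) {lam : ℝ}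
    (hlam0 : 0 ≤ lam) (hlam : lam < 1 / 2) (hd : GapDensityPos lam)
    (h₀ : (closeCriticalZeros 2001).Nonempty) :
    ∃ c : ℝ, 0 < c ∧ SubnormalGapsHypothesis c :=
  subnormalGapsHypothesis_of_eventually
    (le_ncard_closeCriticalZeros_of_gapDensityPos hRH hlam0 hlam hd) h₀

/-- **The whole chain, modulo Conrey–Iwaniec's Theorem 1.2** (tree fact
`conreyIwaniec2002_theorem12`): on RH, a positive density of distinct gaps below `λ₀ < ½` mean
spacings (`μ_{D_d} < ½`; print: `μ_{D_d} ≤ 1.0522`, `μ_D ≤ 0.6039`) plus one close pair below height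
`2001` give the effective `L(1,χ) ≫ (log q)^{−90}` for every real primitive odd `χ` mod `q > 4`.
This is what the literature of rows T-005/T-006 "would need to bite": the threshold `½`
(deficit `0.552` resp. `0.104` mean spacings at positive density) — and an RH-free proof, since under
RH the conclusion is already classical (Conrey–Iwaniec §1 p. 3).
[cite: ConreyIwaniec2002, Theorem 1.2] -/
theorem lOne_lower_bound_of_gapDensityPos (hCI : conreyIwaniec2002_theorem12)
    (hRH : RiemannHypothesis) {lam : ℝ} (hlam0 : 0 ≤ lam) (hlam : lam < 1 / 2)
    (hd : GapDensityPos lam) (h₀ : (closeCriticalZeros 2001).Nonempty) :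
    ∃ c' : ℝ, 0 < c' ∧
      ∀ (q : ℕ) [NeZero q], 4 < q → ∀ χ : DirichletCharacter ℂ q,
        χ.IsPrimitive → χ.IsQuadratic → χ.Odd →
          c' * Real.log q ^ (-(90 : ℝ)) ≤ ‖χ.LFunction 1‖ := by
  obtain ⟨c, hc, hS⟩ := subnormalGapsHypothesis_of_gapDensityPos hRH hlam0 hlam hd h₀
  obtain ⟨c', hc', h⟩ := hCI c hc
  exact ⟨c', hc', fun q _ hq χ hp hquad hodd => h hS q hq χ hp hquad hodd⟩

end BGMM2023

end Literature.NumberTheory.LFunctions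

end
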